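import Summits.CriticalPhenomena.PercolationContinuityZ3.Theorems.PercNearOneGluingAdditiveGluingSuffices

/-!
# `AdditiveGluingGlue`: the additive gluing inequality implies near-one gluing

The additive gluing inequality `AdditiveGluing` implies
`NearOneGluing` (Kozma–Nitzan near-one gluing, Conjecture 3 form) with `δ = ε / 2`.
The statement `AdditiveGluingGlue := AdditiveGluing → NearOneGluing` is definitionally the
already-proved `AdditiveGluingSuffices`, so the proof
is a direct application of `additiveGluingSuffices_proof`.
-/

namespace Summit.CriticalPhenomena.PercolationContinuityZ3.Theorems

open Summit.CriticalPhenomena.PercolationContinuityZ3.Theses.PercNearOneGluing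

/-- **AdditiveGluing ⇒ NearOneGluing** (`δ = ε / 2`): unfold the definition and
apply `additiveGluingSuffices_proof`, whose statement is
definitionally `AdditiveGluing → NearOneGluing`. -/
theorem additiveGluingGlue_proof : AdditiveGluingGlue := by
  unfold AdditiveGluingGlue
  intro hAG
  exact additiveGluingSuffices_proof hAG

end Summit.CriticalPhenomena.PercolationContinuityZ3.Theorems
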